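import Summits.RiemannHypothesis.RiemannHypothesis.Theses.LiTailLaguerre
import Summits.RiemannHypothesis.RiemannHypothesis.Theorems.LiTailLaguerrePolarTail
import Summits.RiemannHypothesis.RiemannHypothesis.Theorems.LiTailLaguerreTailAdjust
import Summits.RiemannHypothesis.RiemannHypothesis.Theorems.LiPrimeEchoAssembly
import HarnessLib

/-!
# RiemannHypothesis / LiTailLaguerre — the ASSEMBLY (RH-FREE bookkeeping)

RH-FREE [rh-li-eng-4].  Route `Theses/LiTailLaguerre.lean` (rung «Li TAIL–LAGUERRE LAW» `LiTheory.LiZeroTailLaguerre`,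
L-P(P1-tail); cell `pub/rh-li`, theory round 7, dossier `theory/route/r7/`), item `Assembly` (stmt-RiemannHypothesis-19706):

  `LiTailContour → LiPrimeTailLaguerre → LiGammaTailShift → LiTailHorizontal → LiTheory.LiZeroTailLaguerre`.

Proof = the theory seat's kernel-checked composition `liZeroTailLaguerre_of` / `assembly_of_supports`
(HOME/theory/route/r7/Sketch.lean, rh-li-theory g9), fed with the two landed RH-FREE skeleton statements
`liPolarTailBound` (polar tail `O(log n)`, `Theorems/LiTailLaguerrePolarTail.lean`) and `liTailAdjust` (cut adjustment
`O(log n)`, `Theorems/LiTailLaguerreTailAdjust.lean`): pick a good height `T' ∈ [c√n, c√n + 1]` (K4′), write the zero tail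
above `T'` by the half-strip contour identity (K1′), replace the gamma tail by the smooth tail (K3′), the prime tail by the
released Laguerre terms (K2′), bound the polar tail and the horizontal edge (support, K4′), and move the cut back to `c√n`
(support); every sign and constant is checked by `linarith`, and "for all large `n`" becomes "for all `n ≥ 2`" with a worse
constant (`PrimeEchoAssembly.eventually_to_all`).  Nothing here bears on the truth of RH: the leaf is an RH-free statement
about the explicit-formula bookkeeping of the zeros above height `c√n`.
-/

noncomputable section

-- D-0017: `Summit.<S>.<S>.…` is the designed namespace of a single-problem summit.
set_option linter.dupNamespace false

namespace Summit.RiemannHypothesis.RiemannHypothesis.Theorems.LiTheory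

open Summit.RiemannHypothesis.RiemannHypothesis.Theses.LiTailLaguerre

namespace TailLaguerreAssembly

/-- **COMPOSITION** (theory seat's `liZeroTailLaguerre_of`, with the two supports already discharged by the tree theorems
`liPolarTailBound` and `liTailAdjust`): K1′ (tail contour identity) + polar tail bound + K3′ (gamma tail shift) + K2′
(prime tail = released Laguerre terms) + K4′ (horizontal edge at a good height) + cut adjustment ⇒ the leaf. -/
theorem liZeroTailLaguerre_of (hA : LiTailContour) (hD : LiGammaTailShift) (hE : LiPrimeTailLaguerre)
    (hF : LiTailHorizontal) : LiZeroTailLaguerre := by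
  intro c hc hedge
  obtain ⟨N₃, C₃, h3⟩ := liPolarTailBound c hc
  obtain ⟨N₄, C₄, h4⟩ := hD c hc
  obtain ⟨N₅, C₅, h5⟩ := hE c hc hedge
  obtain ⟨N₆, C₆, h6⟩ := hF c hc
  obtain ⟨N₇, C₇, h7⟩ := liTailAdjust c hc
  obtain ⟨N₀, hN₀⟩ := exists_nat_gt ((c + 1) ^ 2 + 1 / c ^ 2)
  set ℓ : ℝ := Real.log 2 with hℓ_def
  have hℓ : 0 < ℓ := Real.log_pos (by norm_num)
  refine PrimeEchoAssembly.eventually_to_all _ (max (max (max N₄ N₅) (max N₆ N₇)) (max N₃ N₀))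
    ((2 * |C₇| + |C₄| + |C₃| + |C₅|) / ℓ + |C₆|) fun n hn h2 ↦ ?_
  have hn3 : N₃ ≤ n := by omega
  have hn4 : N₄ ≤ n := by omega
  have hn5 : N₅ ≤ n := by omega
  have hn6 : N₆ ≤ n := by omega
  have hn7 : N₇ ≤ n := by omega
  have hnN₀ : (N₀ : ℝ) ≤ n := by exact_mod_cast (show N₀ ≤ n by omega)
  have hc2 : 0 < 1 / c ^ 2 := by positivity
  set s : ℝ := Real.sqrt n with hs_def
  have hs0 : 0 ≤ s := Real.sqrt_nonneg _
  have hs_sq : s ^ 2 = n := Real.sq_sqrt (Nat.cast_nonneg n)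
  have hs1 : c + 1 ≤ s := by
    rw [← Real.sqrt_sq (by linarith : 0 ≤ c + 1)]
    exact Real.sqrt_le_sqrt (by linarith)
  have hsc : 1 / c ≤ s := by
    rw [← Real.sqrt_sq (le_of_lt (one_div_pos.mpr hc))]
    refine Real.sqrt_le_sqrt ?_
    rw [one_div_pow]
    nlinarith [sq_nonneg (c + 1)]
  have hcs1 : 1 ≤ c * s := by
    have := mul_le_mul_of_nonneg_left hsc hc.le
    rwa [mul_one_div_cancel hc.ne'] at this
  have hcsn : c * s + 1 ≤ n := by
    have h1 : (c + 1) * 1 ≤ s * (s - c) := mul_le_mul hs1 (by linarith) zero_le_one hs0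
    nlinarith [h1, hs_sq]
  obtain ⟨T', hT'l, hT'u, hgood, hH⟩ := h6 n hn6 (c * s) le_rfl (by linarith)
  have hid := hA n T' (by omega) (le_trans hcs1 hT'l) hgood
  have hpol := h3 n hn3 T' hT'l (by linarith)
  have hgam := h4 n hn4 T' hT'l (by linarith)
  have hpr := h5 n hn5 T' hT'l hT'u
  obtain ⟨hadjZ, hadjS⟩ := h7 n hn7 T' hT'l hT'u
  have key : liZeroTail n (c * s) - liSmoothTail n (c * s)
        + ∑ m ∈ Finset.Icc 2 ⌊Real.exp (1 / c ^ 2)⌋₊, liCoffeyTerm m n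
      = (liZeroTail n (c * s) - liZeroTail n T') - (liSmoothTail n (c * s) - liSmoothTail n T')
        + liPolarTail n T' + (liGammaTail n T' - liSmoothTail n T')
        - (liPrimeTail n T' - ∑ m ∈ Finset.Icc 2 ⌊Real.exp (1 / c ^ 2)⌋₊, liCoffeyTerm m n)
        + liHorizTail n T' := by
    rw [hid]; ring
  rw [key]
  set L : ℝ := Real.log n with hL_def
  have hLℓ : ℓ ≤ L := Real.log_le_log (by norm_num) (by exact_mod_cast h2)
  have hL0 : 0 ≤ L := hℓ.le.trans hLℓ
  have hL2 : L ≤ L ^ 2 / ℓ := by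
    rw [le_div_iff₀ hℓ, sq]; exact mul_le_mul_of_nonneg_left hLℓ hL0
  have b7 : C₇ * L ≤ |C₇| * (L ^ 2 / ℓ) :=
    (mul_le_mul_of_nonneg_right (le_abs_self C₇) hL0).trans (mul_le_mul_of_nonneg_left hL2 (abs_nonneg _))
  have b3 : C₃ * L ≤ |C₃| * (L ^ 2 / ℓ) :=
    (mul_le_mul_of_nonneg_right (le_abs_self C₃) hL0).trans (mul_le_mul_of_nonneg_left hL2 (abs_nonneg _))
  have b4 : C₄ * L ≤ |C₄| * (L ^ 2 / ℓ) :=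
    (mul_le_mul_of_nonneg_right (le_abs_self C₄) hL0).trans (mul_le_mul_of_nonneg_left hL2 (abs_nonneg _))
  have b5 : C₅ * L ≤ |C₅| * (L ^ 2 / ℓ) :=
    (mul_le_mul_of_nonneg_right (le_abs_self C₅) hL0).trans (mul_le_mul_of_nonneg_left hL2 (abs_nonneg _))
  have b6 : C₆ * L ^ 2 ≤ |C₆| * L ^ 2 := mul_le_mul_of_nonneg_right (le_abs_self C₆) (sq_nonneg _)
  have e : ((2 * |C₇| + |C₄| + |C₃| + |C₅|) / ℓ + |C₆|) * L ^ 2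
      = 2 * (|C₇| * (L ^ 2 / ℓ)) + |C₄| * (L ^ 2 / ℓ) + |C₃| * (L ^ 2 / ℓ) + |C₅| * (L ^ 2 / ℓ)
        + |C₆| * L ^ 2 := by
    field_simp
  rw [e]
  rw [abs_le] at hadjZ hadjS hpol hgam hpr hH ⊢
  constructor <;> linarith [hadjZ.1, hadjZ.2, hadjS.1, hadjS.2, hpol.1, hpol.2, hgam.1, hgam.2,
    hpr.1, hpr.2, hH.1, hH.2]

end TailLaguerreAssembly

/-- **Item `Assembly` of route `LiTailLaguerre`** (stmt-RiemannHypothesis-19706; RH-FREE bookkeeping), closed BY NAME: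
the theory seat's composition with the landed skeleton statements `liPolarTailBound` and `liTailAdjust` inside. -/
theorem liTailLaguerre_assembly_proof : Summit.RiemannHypothesis.RiemannHypothesis.Theses.LiTailLaguerre.Assembly :=
  fun h1 h2 h4 h5 ↦ TailLaguerreAssembly.liZeroTailLaguerre_of h1 h4 h2 h5

end Summit.RiemannHypothesis.RiemannHypothesis.Theorems.LiTheory

end
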